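import Mathlib.Data.Finset.Sort
import Summits.MatrixMultiplication.OmegaCensus.IndepSetSearch
import Summits.MatrixMultiplication.OmegaCensus.BoxIndependence
import Summits.MatrixMultiplication.OmegaCensus.S3BoxData
import Literature.Computability.AlgebraicComplexity.TPPGroupExtension

/-!
# ω-census, family (b3): independent cell sets in the `S₃` boxes `S₃ × Y × W`, `|Y|, |W| ≤ 3`, have at most 10 elements

HONEST FRAMING (pub-omega census; verbatim): lottery ticket; floor = certified bounds/negative ranges.
Census BOOKKEEPING — the kernel form of the tpp lane's machine constant `α_{S₃}(6,3,3) = 10` that `ProductBoxBound.lean`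
left unchecked ("those constants are NOT kernel-checked here").  With `box_bound` it gives, for EVERY finite abelian group `A`
and every TPP triple `(S, T, U)` of `S₃ × A` (here `S₃ = DihedralGroup 3`) with `|T|, |U| ≤ 3`: `|S||T||U| ≤ 10·|A|`; hence
`S₃ × A` does not realize `⟨N, 3, 3⟩` once `10|A| < 9N` — the census frontier cells `(32,3,3)` in `S₃ × C₂₈` and `S₃ × C₂ × C₁₄`
(order 168) and `(35,3,3)` in `S₃ × C₃₁` (order 186) among them.  All values here are certified NEGATIVE ranges for single TPP
triples in groups of pseudo-exponent well above `2.5`; nothing in this file is progress on `ω`.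

## The finite statement and its proof
Cells are `P = (x, y, w) ∈ S₃ × Y × W`; `P ≠ P'` INTERACT when `cellWord P P' = 1` or `cellWord P' P = 1`
(`cellWord P P' = x x'⁻¹ (y y'⁻¹) (w w'⁻¹)`, `ProductBoxBound`); an independent set has no interacting pair.  CLAIM: every
independent set inside `S₃ × Y × W` with `|Y| = |W| = 3` has at most `10` cells (the value `10` is attained in `396` of the `400`
boxes and is `6` in the four with `Y, W ∈ {A₃, S₃ ∖ A₃}`; engine facts, not used).  Companion files: `BoxIndependence.lean`
(`BoxOK` and its symmetries, any group), `S3BoxData.lean` (enumeration `el`/`ix`, tables, Boolean checkers), `IndepSetSearch.lean`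
(the branch-and-bound checker `noIndep` and its soundness).
1. SYMMETRY (`BoxIndep.BoxOK.of_mulY/of_mulW/of_conj/of_swap`, any group): right translation of `Y` or of `W`, simultaneous conjugation,
   and the swap `(x, y, w) ↦ (x, w, y)` (which reverses the order of the cell word up to conjugation) carry independent sets to
   independent sets of another box; under these the `20 × 20 = 400` pairs `(Y, W)` of `3`-subsets of `S₃` form FOUR classes,
   with representatives `YL r, WL r` (`r < 4`).  The class of each pair and the group elements moving it to its representative
   are a literal table `S3BoxData.covTab`, verified HERE in the kernel (`coverAll_ok`, one `decide`).
2. SEARCH (`IndepSetSearch.noIndep`): for each representative the `54`-vertex conflict graph is a literal adjacency table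
   `S3BoxData.adjTab r`, verified HERE against `cellWord` in `DihedralGroup 3` (`tabOK`, `rep*_ok`), and the branch-and-bound checker with the first-fit
   clique-partition bound refutes an independent `11`-set (`1 / 599 / 455 / 1777` search nodes; `decide`, default heartbeats).
3. GLUE (`boxOK_of_tables`): an independent set of the representative box is coded injectively into `range 54`
   (`9·ix x + 3·pos y + pos w`) as an `adjTab`-independent set of naturals.
Sizing / second reading: the lit seat's LP/ILP study of the same 100 normalised boxes (`run/shared/lean/pub/pub-omega/
pub-omega-lit-g17/alpha-boxes/`, kit j190574: `α = 10` in 99 boxes, `6` in one; plain B&B `1.68·10⁶` nodes) and this seat's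
`code/d3.py` (orbits `4/72/108/216`, node counts above).  New elementary mathematics of the cell (a finite check), not a published
statement: it lives under `Summits/`, not `Literature/`.
-/

open Finset
open Literature.Combinatorics.Additive
open Summit.MatrixMultiplication.OmegaCensus.ProductBoxBound
open Summit.MatrixMultiplication.OmegaCensus.IndepSearch
open Summit.MatrixMultiplication.OmegaCensus.BoxIndep

namespace Summit.MatrixMultiplication.OmegaCensus.S3Box

/-! ## From the tables to `BoxOK 10` for the four representatives -/

/-- Reading `tabOK`. [folklore] -/
theorem interact_of_tabOK {Yl Wl tab : List ℕ} (h : tabOK Yl Wl tab = true) {c c' : ℕ} (hc : c < 54) (hc' : c' < 54)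
    (ht : (tab.getD c 0).testBit c' = true) :
    c ≠ c' ∧ (cellWord (cellOf Yl Wl c) (cellOf Yl Wl c') = 1 ∨ cellWord (cellOf Yl Wl c') (cellOf Yl Wl c) = 1) := by
  simp only [tabOK, List.all_eq_true, List.mem_range, Bool.or_eq_true, Bool.and_eq_true,
    decide_eq_true_eq, ne_eq, Bool.not_eq_eq_eq_not, Bool.not_true, beq_eq_false_iff_ne] at h
  rcases h c hc c' hc' with h | h
  · rw [ht] at h; exact absurd h (by decide)
  · exact h

/-- **Glue.** If the adjacency table of the box `(Yl, Wl)` (three distinct indices `< 6` each) is verified and the checker refutes an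
independent `11`-set of naturals, the box `S₃ × Y × W` satisfies `BoxOK 10`: an independent cell set is coded injectively by
`P ↦ 9·ix x + 3·pos y + pos w` into an `adjTab`-independent subset of `range 54`. [folklore] -/
theorem boxOK_of_tables {Yl Wl tab : List ℕ} (hYl : Yl.length = 3) (hWl : Wl.length = 3)
    (hY6 : ∀ a ∈ Yl, a < 6) (hW6 : ∀ a ∈ Wl, a < 6) (htab : tabOK Yl Wl tab = true)
    (hs : noIndep (fun a => tab.getD a 0) (List.range 54) (2 ^ 54 - 1) 11 = true) :
    BoxOK 10 (univ : Finset Q) (Yl.map el).toFinset (Wl.map el).toFinset := by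
  classical
  intro I hI hind
  -- the code of a cell and its left inverse `cellOf` on the box
  let code : Q × Q × Q → ℕ := fun P => 9 * ix P.1 + 3 * Yl.idxOf (ix P.2.1) + Wl.idxOf (ix P.2.2)
  have hmemY : ∀ {y : Q}, y ∈ (Yl.map el).toFinset → ix y ∈ Yl := by
    intro y hy
    rw [List.mem_toFinset, List.mem_map] at hy
    obtain ⟨a, ha, rfl⟩ := hy
    rwa [ix_el a (hY6 a ha)]
  have hmemW : ∀ {w : Q}, w ∈ (Wl.map el).toFinset → ix w ∈ Wl := by
    intro w hw
    rw [List.mem_toFinset, List.mem_map] at hw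
    obtain ⟨a, ha, rfl⟩ := hw
    rwa [ix_el a (hW6 a ha)]
  have hdec : ∀ P ∈ I, code P < 54 ∧ cellOf Yl Wl (code P) = P := by
    rintro ⟨x, y, w⟩ hP
    have hP' := hI hP
    simp only [mem_product, mem_univ, true_and] at hP'
    have hy := hmemY hP'.1
    have hw := hmemW hP'.2
    have hj : Yl.idxOf (ix y) < 3 := hYl ▸ List.idxOf_lt_length_of_mem hy
    have hk : Wl.idxOf (ix w) < 3 := hWl ▸ List.idxOf_lt_length_of_mem hw
    have hx := ix_lt x
    refine ⟨by simp only [code]; omega, ?_⟩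
    have e1 : (9 * ix x + 3 * Yl.idxOf (ix y) + Wl.idxOf (ix w)) / 9 = ix x := by omega
    have e2 : (9 * ix x + 3 * Yl.idxOf (ix y) + Wl.idxOf (ix w)) / 3 % 3 = Yl.idxOf (ix y) := by omega
    have e3 : (9 * ix x + 3 * Yl.idxOf (ix y) + Wl.idxOf (ix w)) % 3 = Wl.idxOf (ix w) := by omega
    have gY : Yl.getD (Yl.idxOf (ix y)) 0 = ix y := by
      rw [List.getD_eq_getElem _ _ (List.idxOf_lt_length_of_mem hy), List.getElem_idxOf]
    have gW : Wl.getD (Wl.idxOf (ix w)) 0 = ix w := by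
      rw [List.getD_eq_getElem _ _ (List.idxOf_lt_length_of_mem hw), List.getElem_idxOf]
    simp only [cellOf, code, e1, e2, e3, gY, gW, el_ix]
  have hinj : Set.InjOn code I := fun P hP P' hP' e => by
    rw [← (hdec P hP).2, ← (hdec P' hP').2, e]
  -- the coded set is independent for the table
  have hJ : IndepN (fun a => tab.getD a 0) (I.image code) := by
    intro a ha b hb hab
    obtain ⟨P, hP, rfl⟩ := mem_image.1 ha
    obtain ⟨P', hP', rfl⟩ := mem_image.1 hb
    cases ht : (tab.getD (code P) 0).testBit (code P')
    · rfl
    · exfalso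
      have hPP' : P ≠ P' := fun e => hab (by rw [e])
      obtain ⟨-, hw⟩ := interact_of_tabOK htab (hdec P hP).1 (hdec P' hP').1 ht
      rw [(hdec P hP).2, (hdec P' hP').2] at hw
      rcases hw with hw | hw
      · exact hind P hP P' hP' hPP' hw
      · exact hind P' hP' P hP hPP'.symm hw
  have hlt := card_lt_of_noIndep_range hs (I.image code) hJ fun a ha => by
    obtain ⟨P, hP, rfl⟩ := mem_image.1 ha; exact (hdec P hP).1
  rw [card_image_of_injOn hinj] at hlt
  omega

/-- Representative `0` (`Y = W = A₃`): table verified and no independent `11`-set (search tree: 1 node). [folklore] -/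
theorem rep0_ok : tabOK (YL 0) (WL 0) (adjTab 0) = true ∧
    noIndep (fun a => (adjTab 0).getD a 0) (List.range 54) (2 ^ 54 - 1) 11 = true := by
  constructor <;> decide +kernel

/-- Representative `1`: table verified and no independent `11`-set (599 nodes). [folklore] -/
theorem rep1_ok : tabOK (YL 1) (WL 1) (adjTab 1) = true ∧
    noIndep (fun a => (adjTab 1).getD a 0) (List.range 54) (2 ^ 54 - 1) 11 = true := by
  constructor <;> decide +kernel

/-- Representative `2`: table verified and no independent `11`-set (455 nodes). [folklore] -/
theorem rep2_ok : tabOK (YL 2) (WL 2) (adjTab 2) = true ∧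
    noIndep (fun a => (adjTab 2).getD a 0) (List.range 54) (2 ^ 54 - 1) 11 = true := by
  constructor <;> decide +kernel

/-- Representative `3`: table verified and no independent `11`-set (1777 nodes). [folklore] -/
theorem rep3_ok : tabOK (YL 3) (WL 3) (adjTab 3) = true ∧
    noIndep (fun a => (adjTab 3).getD a 0) (List.range 54) (2 ^ 54 - 1) 11 = true := by
  constructor <;> decide +kernel

/-- The four representative boxes satisfy `BoxOK 10`. [folklore] -/
theorem boxOK_rep (r : ℕ) (hr : r ≤ 3) : BoxOK 10 (univ : Finset Q) ((YL r).map el).toFinset ((WL r).map el).toFinset := by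
  interval_cases r
  · exact boxOK_of_tables rfl rfl (by decide) (by decide) rep0_ok.1 rep0_ok.2
  · exact boxOK_of_tables rfl rfl (by decide) (by decide) rep1_ok.1 rep1_ok.2
  · exact boxOK_of_tables rfl rfl (by decide) (by decide) rep2_ok.1 rep2_ok.2
  · exact boxOK_of_tables rfl rfl (by decide) (by decide) rep3_ok.1 rep3_ok.2

/-! ## Every pair of `3`-subsets is carried to a representative -/

/-- The covering table is correct (one kernel evaluation over the `400` pairs). [folklore] -/
theorem coverAll_ok : coverAll = true := by decide +kernel

/-- Increasing triples below `6` are listed in `trip`. [folklore] -/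
theorem mem_trip : ∀ k < 6, ∀ j < k, ∀ i < j, [i, j, k] ∈ trip := by decide

/-- `sameSet` means equal member sets. [folklore] -/
theorem mem_iff_of_sameSet {l l' : List ℕ} (h : sameSet l l' = true) (a : ℕ) : a ∈ l ↔ a ∈ l' := by
  simp only [sameSet, Bool.and_eq_true, List.all_eq_true, List.elem_iff] at h
  exact ⟨h.1 a, h.2 a⟩

/-- Translating then conjugating the listed finset of `L` gives the listed finset of the transformed index list. [folklore] -/
theorem transform_toFinset (L : List ℕ) (g c : Q) :
    (((L.map el).toFinset.image (· * g)).image fun y => c * y * c⁻¹) =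
      ((L.map fun a => ix (c * (el a * g) * c⁻¹)).map el).toFinset := by
  ext q
  simp only [mem_image, List.mem_toFinset, List.mem_map]
  constructor
  · rintro ⟨y, ⟨x, ⟨a, ha, rfl⟩, rfl⟩, rfl⟩
    exact ⟨ix (c * (el a * g) * c⁻¹), ⟨a, ha, rfl⟩, el_ix _⟩
  · rintro ⟨b, ⟨a, ha, rfl⟩, rfl⟩
    exact ⟨el a * g, ⟨el a, ⟨a, ha, rfl⟩, rfl⟩, (el_ix _).symm⟩

/-- Lists with the same members list the same finset. [folklore] -/
theorem toFinset_eq_of_sameSet {l l' : List ℕ} (h : sameSet l l' = true) : (l.map el).toFinset = (l'.map el).toFinset := by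
  ext q
  simp only [List.mem_toFinset, List.mem_map]
  constructor
  · rintro ⟨a, ha, rfl⟩; exact ⟨a, (mem_iff_of_sameSet h a).1 ha, rfl⟩
  · rintro ⟨a, ha, rfl⟩; exact ⟨a, (mem_iff_of_sameSet h a).2 ha, rfl⟩

/-- A `3`-subset of `S₃` is the listed finset of an increasing index triple in `trip`. [folklore] -/
theorem exists_trip_of_card_three (Y : Finset Q) (hY : Y.card = 3) : ∃ L ∈ trip, (L.map el).toFinset = Y := by
  classical
  set L := (Y.image ix).sort with hL
  have hlen : L.length = 3 := by
    rw [hL, length_sort, card_image_of_injective _ ix_injective, hY]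
  have hnd : L.Nodup := sort_nodup _ _
  have hpw : L.Pairwise (· ≤ ·) := pairwise_sort _ _
  have hmem : ∀ a, a ∈ L ↔ a ∈ Y.image ix := fun a => by rw [hL, mem_sort]
  have hY' : (L.map el).toFinset = Y := by
    ext q
    simp only [List.mem_toFinset, List.mem_map, hmem, mem_image]
    constructor
    · rintro ⟨a, ⟨y, hy, rfl⟩, rfl⟩; rwa [el_ix]
    · intro hq; exact ⟨ix q, ⟨q, hq, rfl⟩, el_ix q⟩
  refine ⟨L, ?_, hY'⟩
  match e : L, hlen with
  | [i, j, k], _ =>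
    have h6 : k < 6 := by
      obtain ⟨y, -, hy⟩ := mem_image.1 ((hmem k).1 (by simp))
      rw [← hy]; exact ix_lt y
    simp only [List.pairwise_cons, List.mem_cons, List.nodup_cons, forall_eq_or_imp, forall_eq,
      List.not_mem_nil, or_false, not_or] at hpw hnd
    exact mem_trip k h6 j (lt_of_le_of_ne hpw.2.1 hnd.2.1) i (lt_of_le_of_ne hpw.1.1 hnd.1.1)

/-- **Main finite theorem.** Every independent cell set inside `S₃ × Y × W` with `|Y| = |W| = 3` has at most `10` elements.
[folklore] -/
theorem boxOK_three (Y W : Finset Q) (hY : Y.card = 3) (hW : W.card = 3) : BoxOK 10 univ Y W := by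
  classical
  obtain ⟨L, hL, rfl⟩ := exists_trip_of_card_three Y hY
  obtain ⟨L', hL', rfl⟩ := exists_trip_of_card_three W hW
  have hc := coverAll_ok
  simp only [coverAll, List.all_eq_true] at hc
  have ht := hc L hL L' hL'
  -- unpack the transformation
  generalize covTab.getD (20 * trip.idxOf L + trip.idxOf L') 0 = p at ht
  simp only [transformOK, Bool.and_eq_true] at ht
  obtain ⟨hA, hB⟩ := ht
  set g₁ := el (p / 2 % 6)
  set g₂ := el (p / 12 % 6)
  set c := el (p / 72 % 6)
  set r := min (p / 432) 3
  have hrep := boxOK_rep r (Nat.min_le_right _ _)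
  rw [← toFinset_eq_of_sameSet hA, ← toFinset_eq_of_sameSet hB, ← transform_toFinset, ← transform_toFinset] at hrep
  by_cases hs : p % 2 = 1
  · simp only [hs, if_true] at hrep
    exact BoxOK.of_swap (BoxOK.of_mulY g₁ (BoxOK.of_mulW g₂ (BoxOK.of_conj c hrep)))
  · simp only [hs, if_false] at hrep
    exact BoxOK.of_mulY g₁ (BoxOK.of_mulW g₂ (BoxOK.of_conj c hrep))

/-! ## Consequences: the box-bound constant `α_{S₃}(6,3,3) ≤ 10` and the census cells -/

/-- **`α_{S₃}(6, 3, 3) ≤ 10` in the kernel.** Every independent set of cells inside a box `X × Y × W` of `S₃ = DihedralGroup 3`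
with `|Y| ≤ 3` and `|W| ≤ 3` has at most `10` elements. [folklore] -/
theorem indep_card_le_ten (X Y W : Finset Q) (hY : Y.card ≤ 3) (hW : W.card ≤ 3) : BoxOK 10 X Y W := by
  classical
  have h6 : 3 ≤ (univ : Finset Q).card := by rw [card_univ, DihedralGroup.card]; omega
  obtain ⟨Y', hYY', -, hY'⟩ := exists_subsuperset_card_eq (subset_univ Y) hY h6
  obtain ⟨W', hWW', -, hW'⟩ := exists_subsuperset_card_eq (subset_univ W) hW h6
  exact (boxOK_three Y' W' hY' hW').mono (subset_univ X) hYY' hWW'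

/-- **Box bound for `S₃ × A`.** For every finite abelian `A` and every TPP triple `(S, T, U)` of `S₃ × A` with `|T| ≤ 3` and
`|U| ≤ 3`: `|S| |T| |U| ≤ 10 · |A|` (`ProductBoxBound.box_bound` with the kernel constant `10`). [folklore] -/
theorem tpp_volume_le_ten_mul_card {A : Type*} [CommGroup A] [Fintype A] [DecidableEq A] (S T U : Finset (Q × A))
    (h : TripleProductProperty S T U) (hT : T.card ≤ 3) (hU : U.card ≤ 3) : S.card * T.card * U.card ≤ 10 * Fintype.card A :=
  box_bound S T U h 10 fun I hI hind =>
    indep_card_le_ten _ _ _ (card_image_le.trans hT) (card_image_le.trans hU) I hI hind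

/-- **No `⟨N, 3, 3⟩` in `S₃ × A` when `10|A| < 9N`.** [folklore] -/
theorem not_realizesTPP_S3_prod {A : Type*} [CommGroup A] [Fintype A] [DecidableEq A] (N : ℕ)
    (hlt : 10 * Fintype.card A < 9 * N) :
    ¬ Literature.Computability.AlgebraicComplexity.RealizesTPP (Q × A) N 3 3 := by
  rintro ⟨S, T, U, hS, hT, hU, h⟩
  have := tpp_volume_le_ten_mul_card S T U h (by omega) (by omega)
  rw [hS, hT, hU] at this
  omega

/-- Census cell `(32, 3, 3)` at order `168`: `S₃ × C₂₈` has no TPP triple of sizes `(32, 3, 3)` (`10·28 = 280 < 288`). [folklore] -/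
theorem S3xC28_no_tpp_32_3_3 :
    ¬ Literature.Computability.AlgebraicComplexity.RealizesTPP (Q × Multiplicative (ZMod 28)) 32 3 3 :=
  not_realizesTPP_S3_prod 32 (by simp)

/-- Census cell `(32, 3, 3)` at order `168`, the other abelian complement: `S₃ × C₂ × C₁₄`. [folklore] -/
theorem S3xC2xC14_no_tpp_32_3_3 :
    ¬ Literature.Computability.AlgebraicComplexity.RealizesTPP
      (Q × (Multiplicative (ZMod 2) × Multiplicative (ZMod 14))) 32 3 3 :=
  not_realizesTPP_S3_prod 32 (by simp [Fintype.card_prod])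

/-- Census cell `(35, 3, 3)` at order `186`: `S₃ × C₃₁` has no TPP triple of sizes `(35, 3, 3)` (`10·31 = 310 < 315`). [folklore] -/
theorem S3xC31_no_tpp_35_3_3 :
    ¬ Literature.Computability.AlgebraicComplexity.RealizesTPP (Q × Multiplicative (ZMod 31)) 35 3 3 :=
  not_realizesTPP_S3_prod 35 (by simp)

/-! ## Appendix (gen 9, append-only): the exclusion in every ordering of the three sizes -/

/-- The census cell does not depend on the ordering convention of the size triple: when `10|A| < 9N`, `S₃ × A` realizes none
of `⟨N,3,3⟩`, `⟨3,N,3⟩`, `⟨3,3,N⟩` (the other two reduce to the first by the cyclic shift of a TPP triple,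
`RealizesTPP.rotate`, Cohn–Umans 2003 Lemma 2.1). [folklore] -/
theorem not_realizesTPP_S3_prod_all_orders {A : Type*} [CommGroup A] [Fintype A] [DecidableEq A] (N : ℕ)
    (hlt : 10 * Fintype.card A < 9 * N) :
    ¬ Literature.Computability.AlgebraicComplexity.RealizesTPP (Q × A) N 3 3 ∧
      ¬ Literature.Computability.AlgebraicComplexity.RealizesTPP (Q × A) 3 N 3 ∧
        ¬ Literature.Computability.AlgebraicComplexity.RealizesTPP (Q × A) 3 3 N :=
  ⟨not_realizesTPP_S3_prod N hlt, fun h => not_realizesTPP_S3_prod N hlt h.rotate,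
    fun h => not_realizesTPP_S3_prod N hlt h.rotate.rotate⟩

/-- `S₃ × C₂₈` realizes none of `⟨32,3,3⟩`, `⟨3,32,3⟩`, `⟨3,3,32⟩`. [folklore] -/
theorem S3xC28_no_tpp_32_3_3_all_orders :
    ¬ Literature.Computability.AlgebraicComplexity.RealizesTPP (Q × Multiplicative (ZMod 28)) 32 3 3 ∧
      ¬ Literature.Computability.AlgebraicComplexity.RealizesTPP (Q × Multiplicative (ZMod 28)) 3 32 3 ∧
        ¬ Literature.Computability.AlgebraicComplexity.RealizesTPP (Q × Multiplicative (ZMod 28)) 3 3 32 :=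
  not_realizesTPP_S3_prod_all_orders 32 (by simp)

/-- `S₃ × C₂ × C₁₄` realizes none of `⟨32,3,3⟩`, `⟨3,32,3⟩`, `⟨3,3,32⟩`. [folklore] -/
theorem S3xC2xC14_no_tpp_32_3_3_all_orders :
    ¬ Literature.Computability.AlgebraicComplexity.RealizesTPP
        (Q × (Multiplicative (ZMod 2) × Multiplicative (ZMod 14))) 32 3 3 ∧
      ¬ Literature.Computability.AlgebraicComplexity.RealizesTPP
          (Q × (Multiplicative (ZMod 2) × Multiplicative (ZMod 14))) 3 32 3 ∧
        ¬ Literature.Computability.AlgebraicComplexity.RealizesTPP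
            (Q × (Multiplicative (ZMod 2) × Multiplicative (ZMod 14))) 3 3 32 :=
  not_realizesTPP_S3_prod_all_orders 32 (by simp [Fintype.card_prod])

/-- `S₃ × C₃₁` realizes none of `⟨35,3,3⟩`, `⟨3,35,3⟩`, `⟨3,3,35⟩`. [folklore] -/
theorem S3xC31_no_tpp_35_3_3_all_orders :
    ¬ Literature.Computability.AlgebraicComplexity.RealizesTPP (Q × Multiplicative (ZMod 31)) 35 3 3 ∧
      ¬ Literature.Computability.AlgebraicComplexity.RealizesTPP (Q × Multiplicative (ZMod 31)) 3 35 3 ∧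
        ¬ Literature.Computability.AlgebraicComplexity.RealizesTPP (Q × Multiplicative (ZMod 31)) 3 3 35 :=
  not_realizesTPP_S3_prod_all_orders 35 (by simp)

end Summit.MatrixMultiplication.OmegaCensus.S3Box
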